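import Summits.Ventures.PercRepro.RankLevelSetBiIndepContainSkew
import Summits.Ventures.PercRepro.RankLevelSetBiIndepTruncate

/-! # RankLevelSetBiIndepContainSkewTruncate — THE (CX*)- AND (CX)-CLASSES ARE CLOSED UNDER TRUNCATION
(night-1 g28; dossier §40.13)

The bi-independent sets of the truncation `truncateTo M r` are those of `M` inside the window `#E − r ≤ k ≤ r`
(g24's `biIndep_truncateTo`), so the contain-`X` profile of the truncation is the windowed profile of `M`
(`biContainCount_truncateTo`). For `2k + 1 < #E` either `k` is outside the window (`α^X_k = 0`) or both `k` and
`#E − 1 − k` (resp. `k + 1`) are inside, where the inequality is that of `M`: **`biContainSkew_truncateTo`** and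
**`biContainMono_truncateTo`**. Every declaration has a docstring; imports: the cell's own modules and Mathlib only.
Axioms: standard. -/

namespace PercRepro

open Set Matroid

variable {α : Type} (M : Matroid α) [M.Finite]

/-- **The contain-`X` profile of the truncation is a window**: `α^X_k(T_r M) = α^X_k(M)` if `k ≤ r` and `#E − k ≤ r`,
else `0`. -/
lemma biContainCount_truncateTo (X : Set α) (r k : ℕ) :
    haveI := truncateTo_finite M r
    biContainCount (truncateTo M r) X k = if k ≤ r ∧ M.E.ncard - k ≤ r then biContainCount M X k else 0 := by
  haveI := truncateTo_finite M r
  unfold biContainCount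
  rw [biIndep_truncateTo]
  split_ifs with hw
  · rfl
  · simp

/-- **THE (CX*)-CLASS IS CLOSED UNDER TRUNCATION**: `BiContainSkew M → BiContainSkew (truncateTo M r)`. -/
theorem biContainSkew_truncateTo (h : BiContainSkew M) (r : ℕ) :
    haveI := truncateTo_finite M r
    BiContainSkew (truncateTo M r) := by
  haveI := truncateTo_finite M r
  intro X hX k hk
  rw [truncateTo_E] at hX hk
  rw [truncateTo_E, biContainCount_truncateTo, biContainCount_truncateTo]
  by_cases hw : k ≤ r ∧ M.E.ncard - k ≤ r
  · rw [if_pos hw]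
    have hw' : M.E.ncard - 1 - k ≤ r ∧ M.E.ncard - (M.E.ncard - 1 - k) ≤ r := by omega
    rw [if_pos hw']
    exact h X hX k hk
  · rw [if_neg hw]
    exact Nat.zero_le _

/-- **THE (CX)-CLASS IS CLOSED UNDER TRUNCATION**: `BiContainMono M → BiContainMono (truncateTo M r)`. -/
theorem biContainMono_truncateTo (h : BiContainMono M) (r : ℕ) :
    haveI := truncateTo_finite M r
    BiContainMono (truncateTo M r) := by
  haveI := truncateTo_finite M r
  intro X hX k hk
  rw [truncateTo_E] at hX hk
  rw [biContainCount_truncateTo, biContainCount_truncateTo]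
  by_cases hw : k ≤ r ∧ M.E.ncard - k ≤ r
  · rw [if_pos hw]
    have hw' : k + 1 ≤ r ∧ M.E.ncard - (k + 1) ≤ r := by omega
    rw [if_pos hw']
    exact h X hX k hk
  · rw [if_neg hw]
    exact Nat.zero_le _

end PercRepro
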